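import Literature.NumberTheory.Sieve.DrappeauTypeICoreGood
import HarnessLib

/-!
# Drappeau's Type I sums, the core estimate II: all index tuples

Topic `Literature/NumberTheory/Sieve`; theorems only, everything PROVED.  Conclusion of the Type I treatment of
S. Drappeau, PLMS 114 (2017) §6.2 (arXiv:1504.05549, p. 22) for the conductor-truncated kernel `𝔲_R` (§5 (5.1)),
in the form consumed by correlation problems with a class condition `W(ν ∏ nᵢ)` depending only on
`ν ∏ nᵢ mod L` (e.g. `ν ∏ nᵢ ≡ e (mod L)`, or a pair of classes to two divisors of `L`) on smooth variables
`nᵢ ∼ Vᵢ` (`i ≤ k`, `k ≤ 2` in the application) and a hyperbolic window `ν ∏ nᵢ ≤ Y`: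

`∑_{s ∈ 𝒮} ‖∑_{nᵢ ∼ Vᵢ} [W(ν∏nᵢ)] [ν∏nᵢ ≤ Y] 𝔲_{Rd}(ν ∏ nᵢ c̄; s)‖
   ≤ (G₀ L)^{k+1} T + (k+1) (∏ 2Vᵢ) τ(L)^{2(k+1)} G₀^{-1/2} (Dv + Rd Ψ₁)`            (`typeI_core`)

with `T` the one-good-tuple bound of `good_tuple_bound` (Fouvry–Tenenbaum's Lemmas 4.12–4.13 enter through its
hypothesis `hFT`), `Ψ₁ = ∑_s τ(s)/φ(s)`: split every `nᵢ = hᵢ nᵢ'` (`sum_piFinset_dyadic_eq_sum_idx`); good index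
tuples (`hᵢ ≤ G₀`) number `≤ (G₀ L)^{k+1}` and each is `good_tuple_bound`; bad ones are bounded trivially by
Drappeau's (5.2), `∑_s |𝔲_{Rd}(N c̄; s)| ≤ #{s ∣ N − c} + Rd Ψ₁`, and are few (`sum_piFinset_idx_bad_le`).

* `sum_norm_uR_le` — the trivial bound summed over the moduli;
* `lt_mul_of_mem_subBox`, `mul_le_of_mem_subBox`, `bounds_of_mem_piFinset_subBox` — `Vᵢ < hᵢnᵢ' ≤ 2Vᵢ`;
* `bad_tuple_bound`, `card_good_le` — the two halves; `typeI_core` — the estimate above.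

## References

* S. Drappeau, Proc. London Math. Soc. (3) 114 (2017) 684–732, §5 (5.2), §6.2. [Drappeau2017]
* É. Fouvry, G. Tenenbaum, Trans. Amer. Math. Soc. 375 (2022), Lemmas 4.12–4.13. [FouvryTenenbaum2021]
-/

open Finset Fintype Real
open scoped ArithmeticFunction.sigma Classical

noncomputable section

namespace Literature.NumberTheory.Sieve

namespace DrappeauTypeI

open Drappeau2017 FouvryTenenbaum2021

/-! ### The trivial bound summed over the moduli -/

/-- **Drappeau's (5.2) summed over the moduli**: for moduli `s ≥ 1` with `(s, c) = 1` and `Rd ≥ 0`,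
`∑_{s ∈ 𝒮} |𝔲_{Rd}(N c̄; s)| ≤ #{s ∈ 𝒮 : s ∣ N − c} + Rd ∑_{s ∈ 𝒮} τ(s)/φ(s)`. [cite: Drappeau2017, §5 (5.2)] -/
theorem sum_norm_uR_le (𝒮 : Finset ℕ) {c : ℤ} (h𝒮 : ∀ s ∈ 𝒮, 1 ≤ s ∧ IsCoprime (s : ℤ) c) {Rd : ℝ} (hRd : 0 ≤ Rd)
    (N : ℕ) :
    ∑ s ∈ 𝒮, ‖uR Rd s ((N : ZMod s) * ((c : ZMod s))⁻¹)‖ ≤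
      ((𝒮.filter (fun s : ℕ => (s : ℤ) ∣ (N : ℤ) - c)).card : ℝ) + Rd * ∑ s ∈ 𝒮, (σ 0 s : ℝ) / (Nat.totient s : ℝ) := by
  have hterm : ∀ s ∈ 𝒮, ‖uR Rd s ((N : ZMod s) * ((c : ZMod s))⁻¹)‖ ≤
      (if (s : ℤ) ∣ (N : ℤ) - c then (1 : ℝ) else 0) + Rd * ((σ 0 s : ℝ) / (Nat.totient s : ℝ)) := by
    intro s hs
    obtain ⟨hs1, hsc⟩ := h𝒮 s hs
    haveI : NeZero s := ⟨by omega⟩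
    refine (norm_uR_le hs1 hRd _).trans (add_le_add ?_ (le_of_eq (by ring)))
    split_ifs with h1 h2
    · exact le_rfl
    · exfalso
      apply h2
      have hcu : IsUnit (c : ZMod s) := (ZMod.coe_int_isUnit_iff_isCoprime c s).2 hsc
      have hN : ((N : ℤ) : ZMod s) = (c : ZMod s) := by
        calc ((N : ℤ) : ZMod s) = ((N : ZMod s) * ((c : ZMod s))⁻¹) * (c : ZMod s) := by
              rw [mul_assoc, ZMod.inv_mul_of_unit _ hcu, mul_one, Int.cast_natCast]
          _ = (c : ZMod s) := by rw [h1, one_mul]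
      rw [← ZMod.intCast_zmod_eq_zero_iff_dvd, Int.cast_sub, hN, sub_self]
    · exact zero_le_one
    · exact le_rfl
  refine (Finset.sum_le_sum hterm).trans ?_
  rw [Finset.sum_add_distrib, ← Finset.mul_sum, Finset.sum_boole]

/-! ### Sizes of the variables in a sub-box -/

/-- `Vᵢ < hᵢ nᵢ'` for `nᵢ' ∈ subBox Vᵢ L (hᵢ, tᵢ)`, `hᵢ ≥ 1`. [folklore] -/
theorem lt_mul_of_mem_subBox {V : ℝ} (hV : 0 ≤ V) {L : ℕ} {p : ℕ × ℕ} (hp : 1 ≤ p.1) {n : ℕ} (hn : n ∈ subBox V L p) :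
    V < (p.1 : ℝ) * n := by
  have hp0 : (0 : ℝ) < p.1 := by exact_mod_cast hp
  have h := ((BFI.mem_dyadic (div_nonneg hV hp0.le)).1 ((mem_subBox hV).1 hn).1).1
  rwa [div_lt_iff₀' hp0] at h

/-- `hᵢ nᵢ' ≤ 2Vᵢ` for `nᵢ' ∈ subBox Vᵢ L (hᵢ, tᵢ)`, `hᵢ ≥ 1`. [folklore] -/
theorem mul_le_of_mem_subBox {V : ℝ} (hV : 0 ≤ V) {L : ℕ} {p : ℕ × ℕ} (hp : 1 ≤ p.1) {n : ℕ} (hn : n ∈ subBox V L p) :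
    (p.1 : ℝ) * n ≤ 2 * V := by
  have hp0 : (0 : ℝ) < p.1 := by exact_mod_cast hp
  have h := ((BFI.mem_dyadic (div_nonneg hV hp0.le)).1 ((mem_subBox hV).1 hn).1).2
  rw [show 2 * (V / p.1) = 2 * V / p.1 by ring, le_div_iff₀' hp0] at h
  exact h

/-- **The size of `N = ν ∏ hᵢnᵢ'`** on a sub-box tuple: `V₀ < N ≤ ν 2^{k+1} ∏ Vᵢ`. [folklore] -/
theorem bounds_of_mem_piFinset_subBox {k : ℕ} {V : Fin (k + 1) → ℝ} (hV : ∀ i, 0 ≤ V i) {L : ℕ}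
    {p : Fin (k + 1) → ℕ × ℕ} (hp : ∀ i, 1 ≤ (p i).1) {ν : ℕ} (hν : 1 ≤ ν) {n : Fin (k + 1) → ℕ}
    (hn : n ∈ piFinset (fun i => subBox (V i) L (p i))) :
    V 0 < ((ν * ∏ i, ((p i).1 * n i) : ℕ) : ℝ) ∧
      ((ν * ∏ i, ((p i).1 * n i) : ℕ) : ℝ) ≤ ν * (2 ^ (k + 1) * ∏ i, V i) := by
  have hni : ∀ i, n i ∈ subBox (V i) L (p i) := fun i => Fintype.mem_piFinset.1 hn i
  constructor
  · have h1 : (p 0).1 * n 0 ≤ ν * ∏ i, ((p i).1 * n i) := by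
      have hone : ∀ i ∈ (Finset.univ : Finset (Fin (k + 1))), 1 ≤ (p i).1 * n i := by
        intro i _
        have := lt_mul_of_mem_subBox (hV i) (hp i) (hni i)
        have h0 : (0 : ℝ) < (p i).1 * n i := lt_of_le_of_lt (hV i) this
        have : 0 < (p i).1 * n i := by exact_mod_cast h0
        omega
      calc (p 0).1 * n 0 ≤ ∏ i, ((p i).1 * n i) := Finset.single_le_prod' hone (Finset.mem_univ 0)
        _ ≤ ν * ∏ i, ((p i).1 * n i) := Nat.le_mul_of_pos_left _ hν
    calc V 0 < ((p 0).1 : ℝ) * n 0 := lt_mul_of_mem_subBox (hV 0) (hp 0) (hni 0)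
      _ ≤ _ := by exact_mod_cast h1
  · push_cast
    refine mul_le_mul_of_nonneg_left ?_ (Nat.cast_nonneg _)
    rw [show (2 : ℝ) ^ (k + 1) * ∏ i, V i = ∏ i, (2 * V i) by
      rw [Finset.prod_mul_distrib, Finset.prod_const, Finset.card_univ, Fintype.card_fin]]
    exact Finset.prod_le_prod (fun i _ => by positivity) fun i _ => mul_le_of_mem_subBox (hV i) (hp i) (hni i)

/-! ### Bad index tuples -/

/-- **One (bad) index tuple, trivially**: if `V₀ ≥ |c|` (so that `ν ∏ hᵢnᵢ' ≠ c`) and the divisor-count bound `Dv`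
is valid up to `Z ≥ ν 2^{k+1} ∏ Vᵢ + |c|`, then
`∑_s ‖∑_{n⃗'} coreTerm(∏ hᵢnᵢ')‖ ≤ #(sub-box tuples) · (Dv + Rd Ψ₁)`. [cite: Drappeau2017, §5 (5.2)] -/
theorem bad_tuple_bound {k : ℕ} {V : Fin (k + 1) → ℝ} (hV : ∀ i, 0 ≤ V i) {c : ℤ} (hcV : (|c| : ℝ) ≤ V 0)
    {L : ℕ} {ν : ℕ} (hν : 1 ≤ ν) (Y : ℝ) {Rd : ℝ} (hRd : 0 ≤ Rd) (𝒮 : Finset ℕ)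
    (h𝒮 : ∀ s ∈ 𝒮, 1 ≤ s ∧ IsCoprime (s : ℤ) c) {Z Dv : ℝ} (hZ : (ν : ℝ) * (2 ^ (k + 1) * ∏ i, V i) + |c| ≤ Z)
    (hDv : ∀ z : ℤ, z ≠ 0 → (|z| : ℝ) ≤ Z → ((𝒮.filter (fun s : ℕ => (s : ℤ) ∣ z)).card : ℝ) ≤ Dv)
    {p : Fin (k + 1) → ℕ × ℕ} (hp : ∀ i, 1 ≤ (p i).1) :
    ∑ s ∈ 𝒮, ‖∑ n ∈ piFinset (fun i => subBox (V i) L (p i)), coreTerm ν Y Rd c s (∏ i, ((p i).1 * n i))‖ ≤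
      ((piFinset (fun i => subBox (V i) L (p i))).card : ℝ) *
        (Dv + Rd * ∑ s ∈ 𝒮, (σ 0 s : ℝ) / (Nat.totient s : ℝ)) := by
  have hper : ∀ n ∈ piFinset (fun i => subBox (V i) L (p i)),
      ∑ s ∈ 𝒮, ‖coreTerm ν Y Rd c s (∏ i, ((p i).1 * n i))‖ ≤ Dv + Rd * ∑ s ∈ 𝒮, (σ 0 s : ℝ) / (Nat.totient s : ℝ) := by
    intro n hn
    obtain ⟨hlo, hhi⟩ := bounds_of_mem_piFinset_subBox hV hp hν hn
    set N : ℕ := ν * ∏ i, ((p i).1 * n i) with hN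
    have hz : ((N : ℤ) - c) ≠ 0 := by
      intro h0
      have h1 : (N : ℝ) = (c : ℝ) := by exact_mod_cast (sub_eq_zero.1 h0)
      have h2 : (c : ℝ) ≤ |(c : ℝ)| := le_abs_self _
      linarith
    have hzle : (|((N : ℤ) - c : ℤ)| : ℝ) ≤ Z := by
      refine le_trans ?_ hZ
      rw [Int.cast_abs, Int.cast_sub, Int.cast_natCast]
      refine (abs_sub _ _).trans ?_
      rw [Nat.abs_cast]
      exact add_le_add hhi le_rfl
    calc ∑ s ∈ 𝒮, ‖coreTerm ν Y Rd c s (∏ i, ((p i).1 * n i))‖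
        ≤ ∑ s ∈ 𝒮, ‖uR Rd s ((N : ZMod s) * ((c : ZMod s))⁻¹)‖ :=
          Finset.sum_le_sum fun s _ => norm_coreTerm_le _ _ _ _ _ _
      _ ≤ ((𝒮.filter (fun s : ℕ => (s : ℤ) ∣ (N : ℤ) - c)).card : ℝ) +
            Rd * ∑ s ∈ 𝒮, (σ 0 s : ℝ) / (Nat.totient s : ℝ) := sum_norm_uR_le 𝒮 h𝒮 hRd N
      _ ≤ Dv + Rd * ∑ s ∈ 𝒮, (σ 0 s : ℝ) / (Nat.totient s : ℝ) := by
          gcongr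
          exact hDv _ hz hzle
  calc ∑ s ∈ 𝒮, ‖∑ n ∈ piFinset (fun i => subBox (V i) L (p i)), coreTerm ν Y Rd c s (∏ i, ((p i).1 * n i))‖
      ≤ ∑ s ∈ 𝒮, ∑ n ∈ piFinset (fun i => subBox (V i) L (p i)), ‖coreTerm ν Y Rd c s (∏ i, ((p i).1 * n i))‖ :=
        Finset.sum_le_sum fun s _ => norm_sum_le _ _
    _ = ∑ n ∈ piFinset (fun i => subBox (V i) L (p i)), ∑ s ∈ 𝒮, ‖coreTerm ν Y Rd c s (∏ i, ((p i).1 * n i))‖ :=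
        Finset.sum_comm
    _ ≤ ∑ _n ∈ piFinset (fun i => subBox (V i) L (p i)), (Dv + Rd * ∑ s ∈ 𝒮, (σ 0 s : ℝ) / (Nat.totient s : ℝ)) :=
        Finset.sum_le_sum hper
    _ = _ := by rw [Finset.sum_const, nsmul_eq_mul]

/-! ### Good index tuples are at most `(G₀ L)^{k+1}` -/

/-- `#{(h, t) ∈ idx L B : h ≤ G₀} ≤ G₀ L`. [folklore] -/
theorem card_idx_filter_le (L B G₀ : ℕ) : ((idx L B).filter (fun q => q.1 ≤ G₀)).card ≤ G₀ * L := by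
  calc ((idx L B).filter (fun q => q.1 ≤ G₀)).card ≤ (Icc 1 G₀ ×ˢ Finset.range L).card := by
        refine Finset.card_le_card fun q hq => ?_
        simp only [idx, Finset.mem_filter, Finset.mem_product, mem_smoothBelow, mem_unitReps] at hq
        simp only [Finset.mem_product, Finset.mem_Icc, Finset.mem_range]
        exact ⟨⟨hq.1.1.1.1, hq.2⟩, hq.1.2.1⟩
    _ = G₀ * L := by rw [Finset.card_product, Nat.card_Icc, Finset.card_range, Nat.add_sub_cancel]

/-- **The good index tuples number at most `(G₀ L)^{k}`** (`k` coordinates). [folklore] -/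
theorem card_good_le {k : ℕ} (L : ℕ) (B : Fin k → ℕ) (G₀ : ℕ) :
    (((piFinset (fun i => idx L (B i))).filter (fun p => ∀ i, (p i).1 ≤ G₀)).card : ℝ) ≤ ((G₀ : ℝ) * L) ^ k := by
  have hsub : (piFinset (fun i => idx L (B i))).filter (fun p => ∀ i, (p i).1 ≤ G₀) ⊆
      piFinset (fun i => (idx L (B i)).filter (fun q => q.1 ≤ G₀)) := by
    intro p hp
    rw [Finset.mem_filter, Fintype.mem_piFinset] at hp
    exact Fintype.mem_piFinset.2 fun i => Finset.mem_filter.2 ⟨hp.1 i, hp.2 i⟩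
  calc (((piFinset (fun i => idx L (B i))).filter (fun p => ∀ i, (p i).1 ≤ G₀)).card : ℝ)
      ≤ ((piFinset (fun i => (idx L (B i)).filter (fun q => q.1 ≤ G₀))).card : ℝ) := by
        exact_mod_cast Finset.card_le_card hsub
    _ = ∏ i, ((((idx L (B i)).filter (fun q => q.1 ≤ G₀)).card : ℕ) : ℝ) := by
        rw [Fintype.card_piFinset, Nat.cast_prod]
    _ ≤ ∏ _i : Fin k, ((G₀ : ℝ) * L) :=
        Finset.prod_le_prod (fun i _ => Nat.cast_nonneg _) fun i _ => by exact_mod_cast card_idx_filter_le L (B i) G₀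
    _ = ((G₀ : ℝ) * L) ^ k := by rw [Finset.prod_const, Finset.card_univ, Fintype.card_fin]

/-! ### The core estimate -/

/-- **Drappeau's Type I estimate for `𝔲_R` against smooth variables with a class condition** (the form consumed by
the Liouville correlation problem).  Data: `k + 1` scales `Vᵢ ≥ V_min > 0` with `Vᵢ ≥ x_F^{1/100} G₀`, `Vᵢ ≥ |c| G₀`,
`∏ Vᵢ ≤ x_F`; a modulus `L ≥ 1` and an `L`-periodic condition `W`; `ν ≥ 1`, `Y ≥ 0`, `H ≥ 1`, `Rd ≥ 1`, a smooth-part cutoff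
`G₀ ≥ 1`; moduli `s ∈ 𝒮`, `s ≤ x_F^θ`, coprime to `cL`; a divisor-count bound `Dv` valid for `0 < |z| ≤ Z` with
`Z ≥ 2^{k+2} ν G₀^{k+1} x_F` and `Z ≥ ν 2^{k+1} ∏Vᵢ + |c|`; and the divisor-function input `hFT` (body of
`FouvryTenenbaum2021.DivisorAPTuple k θ`, constants `δ, C₀, C ≥ 0`).  Then
`∑_{s ∈ 𝒮} ‖∑_{nᵢ ∼ Vᵢ} [W(ν∏nᵢ)] [ν∏nᵢ ≤ Y] 𝔲_{Rd}(ν∏nᵢ c̄; s)‖ ≤ (G₀L)^{k+1} T +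
(k+1)(∏ 2Vᵢ) τ(L)^{2(k+1)} G₀^{-1/2} (Dv + Rd Ψ₁)`, `T` as in `good_tuple_bound`. [cite: Drappeau2017, §6.2] -/
theorem typeI_core {k : ℕ} {θ δ C₀ C : ℝ}
    (hFT : ∀ x : ℝ, 1 ≤ x → ∀ (M lo hi : Fin k → ℝ) (Ml lol hil : ℝ), Monotone M → (∀ i, M i ≤ Ml) →
      (∀ i, x ^ (1 / 100 : ℝ) ≤ M i) → x ^ (1 / 100 : ℝ) ≤ Ml → (∏ i, M i) * Ml ≤ x →
      (∀ i, M i ≤ lo i) → (∀ i, hi i ≤ 2 * M i) → Ml ≤ lol → hil ≤ 2 * Ml →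
      ∀ (s D : ℕ) (a : ℤ) (t : Fin k → ℤ) (tl : ℤ), 1 ≤ s → (s : ℝ) ≤ x ^ θ → 1 ≤ D →
      IsCoprime (s : ℤ) (a * D) → (∀ i, IsCoprime (t i) (D : ℤ)) → IsCoprime tl (D : ℤ) →
      |∑ m ∈ piFinset (fun i => apBox (lo i) (hi i) D (t i)), ∑ n ∈ apBox lol hil D tl,
          gAP s a ((∏ i, m i) * n)| ≤ C * (D : ℝ) ^ C₀ * x ^ (1 - δ) / (Nat.totient s : ℝ))
    (hC : 0 ≤ C) {xF : ℝ} (hxF : 1 ≤ xF) {V : Fin (k + 1) → ℝ} {Vmin : ℝ} (hVmin : 0 < Vmin)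
    (hVminV : ∀ i, Vmin ≤ V i) {G₀ : ℕ} (hG₀ : 1 ≤ G₀) (hV1 : ∀ i, xF ^ (1 / 100 : ℝ) * G₀ ≤ V i)
    {c : ℤ} (hcV : ∀ i, (|c| : ℝ) * G₀ ≤ V i) (hprod : ∏ i, V i ≤ xF) {L : ℕ} (hL : 1 ≤ L)
    (W : ℕ → Prop) [DecidablePred W] (hW : ∀ m m' : ℕ, (m : ZMod L) = (m' : ZMod L) → (W m ↔ W m'))
    {ν : ℕ} (hν : 1 ≤ ν) {Y : ℝ} (hY : 0 ≤ Y) {H : ℕ} (hH : 1 ≤ H) {Rd : ℝ} (hRd : 1 ≤ Rd) (𝒮 : Finset ℕ)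
    (h𝒮 : ∀ s ∈ 𝒮, 1 ≤ s ∧ s.Coprime L ∧ IsCoprime (s : ℤ) c ∧ (s : ℝ) ≤ xF ^ θ)
    {Z Dv : ℝ} (hZ1 : (2 : ℝ) ^ (k + 2) * ν * (G₀ : ℝ) ^ (k + 1) * xF ≤ Z)
    (hZ2 : (ν : ℝ) * (2 ^ (k + 1) * ∏ i, V i) + |c| ≤ Z)
    (hDv : ∀ z : ℤ, z ≠ 0 → (|z| : ℝ) ≤ Z → ((𝒮.filter (fun s : ℕ => (s : ℤ) ∣ z)).card : ℝ) ≤ Dv) :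
    ∑ s ∈ 𝒮, ‖∑ n ∈ piFinset (fun i => BFI.dyadic (V i)),
        (if W (ν * ∏ i, n i) then coreTerm ν Y Rd c s (∏ i, n i) else 0)‖ ≤
      ((G₀ : ℝ) * L) ^ (k + 1) *
        ((H : ℝ) ^ k * (C * (L : ℝ) ^ C₀ * xF ^ (1 - δ)) * ∑ s ∈ 𝒮, ((Nat.totient s : ℝ))⁻¹ +
          ((k : ℝ) * Y / (ν * H) + 2 ^ k * xF * G₀ / Vmin) * (Dv + ∑ s ∈ 𝒮, ((Nat.totient s : ℝ))⁻¹) +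
          Rd ^ 2 * (2 ^ k * xF * G₀ / Vmin) * ∑ s ∈ 𝒮, (σ 0 s : ℝ) ^ 2 / (Nat.totient s : ℝ)) +
      ((k : ℝ) + 1) * (∏ i, (2 * V i)) * ((σ 0 L : ℝ) ^ 2) ^ (k + 1) * (G₀ : ℝ) ^ (-(1 / 2 : ℝ)) *
        (Dv + Rd * ∑ s ∈ 𝒮, (σ 0 s : ℝ) / (Nat.totient s : ℝ)) := by
  have hL0 : 0 < L := hL
  have hV0 : ∀ i, 0 ≤ V i := fun i => hVmin.le.trans (hVminV i)
  have hG₀' : (1 : ℝ) ≤ G₀ := by exact_mod_cast hG₀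
  have hRd0 : 0 ≤ Rd := by linarith
  have hcV0 : (|c| : ℝ) ≤ V 0 := le_trans (le_mul_of_one_le_right (abs_nonneg _) hG₀') (hcV 0)
  have h𝒮' : ∀ s ∈ 𝒮, 1 ≤ s ∧ IsCoprime (s : ℤ) c := fun s hs => ⟨(h𝒮 s hs).1, (h𝒮 s hs).2.2.1⟩
  -- abbreviations
  set T : ℝ := (H : ℝ) ^ k * (C * (L : ℝ) ^ C₀ * xF ^ (1 - δ)) * ∑ s ∈ 𝒮, ((Nat.totient s : ℝ))⁻¹ +
      ((k : ℝ) * Y / (ν * H) + 2 ^ k * xF * G₀ / Vmin) * (Dv + ∑ s ∈ 𝒮, ((Nat.totient s : ℝ))⁻¹) +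
      Rd ^ 2 * (2 ^ k * xF * G₀ / Vmin) * ∑ s ∈ 𝒮, (σ 0 s : ℝ) ^ 2 / (Nat.totient s : ℝ) with hT
  set E : ℝ := Dv + Rd * ∑ s ∈ 𝒮, (σ 0 s : ℝ) / (Nat.totient s : ℝ) with hE
  set PI := piFinset (fun i : Fin (k + 1) => idx L ⌊2 * V i⌋₊) with hPI
  -- the per-tuple quantity
  set Q : (Fin (k + 1) → ℕ × ℕ) → ℝ := fun p =>
    ∑ s ∈ 𝒮, ‖∑ n ∈ piFinset (fun i => subBox (V i) L (p i)), coreTerm ν Y Rd c s (∏ i, ((p i).1 * n i))‖ with hQ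
  have hQ0 : ∀ p, 0 ≤ Q p := fun p => Finset.sum_nonneg fun _ _ => norm_nonneg _
  have hpi1 : ∀ p ∈ PI, ∀ i, 1 ≤ (p i).1 := by
    intro p hp i
    have h := Fintype.mem_piFinset.1 hp i
    simp only [idx, Finset.mem_product, mem_smoothBelow] at h
    exact h.1.1.1
  -- Step 1–2: split the variables and move the norm inside
  have hstep : ∑ s ∈ 𝒮, ‖∑ n ∈ piFinset (fun i => BFI.dyadic (V i)),
      (if W (ν * ∏ i, n i) then coreTerm ν Y Rd c s (∏ i, n i) else 0)‖ ≤ ∑ p ∈ PI, Q p := by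
    have h1 : ∀ s, ∑ n ∈ piFinset (fun i => BFI.dyadic (V i)),
        (if W (ν * ∏ i, n i) then coreTerm ν Y Rd c s (∏ i, n i) else 0) =
        ∑ p ∈ PI, ∑ n ∈ piFinset (fun i => subBox (V i) L (p i)),
          (if W (ν * ∏ i, ((p i).1 * (p i).2)) then
            coreTerm ν Y Rd c s (∏ i, ((p i).1 * n i)) else 0) := by
      intro s
      rw [sum_piFinset_dyadic_eq_sum_idx hL0 hV0]
      refine Finset.sum_congr rfl fun p _ => Finset.sum_congr rfl fun n hn => ?_
      rw [if_congr (hW _ _ (natCast_prod_mul_eq_of_mem hV0 ν hn)) rfl rfl]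
    calc _ = ∑ s ∈ 𝒮, ‖∑ p ∈ PI, ∑ n ∈ piFinset (fun i => subBox (V i) L (p i)),
          (if W (ν * ∏ i, ((p i).1 * (p i).2)) then
            coreTerm ν Y Rd c s (∏ i, ((p i).1 * n i)) else 0)‖ := by
          refine Finset.sum_congr rfl fun s _ => ?_; rw [h1 s]
      _ ≤ ∑ s ∈ 𝒮, ∑ p ∈ PI, ‖∑ n ∈ piFinset (fun i => subBox (V i) L (p i)),
          coreTerm ν Y Rd c s (∏ i, ((p i).1 * n i))‖ := by
          refine Finset.sum_le_sum fun s _ => (norm_sum_le _ _).trans (Finset.sum_le_sum fun p _ => ?_)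
          exact norm_sum_ite_const_le _ _ _
      _ = ∑ p ∈ PI, Q p := Finset.sum_comm
  refine hstep.trans ?_
  -- nonnegativity of the constants
  have hΦ0 : 0 ≤ ∑ s ∈ 𝒮, ((Nat.totient s : ℝ))⁻¹ := Finset.sum_nonneg fun _ _ => inv_nonneg.2 (Nat.cast_nonneg _)
  have hΨ0 : 0 ≤ ∑ s ∈ 𝒮, (σ 0 s : ℝ) ^ 2 / (Nat.totient s : ℝ) := Finset.sum_nonneg fun _ _ => by positivity
  have hΨ10 : 0 ≤ ∑ s ∈ 𝒮, (σ 0 s : ℝ) / (Nat.totient s : ℝ) := Finset.sum_nonneg fun _ _ => by positivity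
  have hDv0 : 0 ≤ Dv := le_trans (Nat.cast_nonneg _) (hDv 1 one_ne_zero (by
    simp only [Int.cast_one, abs_one]
    refine le_trans ?_ hZ1
    have h2 : (1 : ℝ) ≤ 2 ^ (k + 2) := one_le_pow₀ (by norm_num)
    have h3 : (1 : ℝ) ≤ ν := by exact_mod_cast hν
    have h4 : (1 : ℝ) ≤ (G₀ : ℝ) ^ (k + 1) := one_le_pow₀ hG₀'
    calc (1 : ℝ) = 1 * 1 * 1 * 1 := by ring
      _ ≤ 2 ^ (k + 2) * ν * (G₀ : ℝ) ^ (k + 1) * xF := by gcongr))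
  have hxF0 : 0 < xF := by linarith
  have hT0 : 0 ≤ T := by rw [hT]; positivity
  have hE0 : 0 ≤ E := by rw [hE]; positivity
  -- Step 3: good and bad tuples
  rw [← Finset.sum_filter_add_sum_filter_not PI (fun p => ∀ i, (p i).1 ≤ G₀)]
  refine add_le_add ?_ ?_
  · -- good
    calc ∑ p ∈ PI.filter (fun p => ∀ i, (p i).1 ≤ G₀), Q p
        ≤ ∑ _p ∈ PI.filter (fun p => ∀ i, (p i).1 ≤ G₀), T := by
          refine Finset.sum_le_sum fun p hp => ?_
          rw [Finset.mem_filter] at hp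
          exact good_tuple_bound hFT hC hxF hVmin hVminV hG₀ hV1 hcV hprod hL hν hY hH hRd 𝒮 h𝒮 hZ1 hDv hp.1 hp.2
      _ = ((PI.filter (fun p => ∀ i, (p i).1 ≤ G₀)).card : ℝ) * T := by rw [Finset.sum_const, nsmul_eq_mul]
      _ ≤ ((G₀ : ℝ) * L) ^ (k + 1) * T := mul_le_mul_of_nonneg_right (card_good_le L _ G₀) hT0
  · -- bad
    have hbad : ∀ p ∈ PI.filter (fun p => ¬ ∀ i, (p i).1 ≤ G₀), Q p ≤
        ((piFinset (fun i => subBox (V i) L (p i))).card : ℝ) * E := by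
      intro p hp
      rw [Finset.mem_filter] at hp
      exact bad_tuple_bound hV0 hcV0 hν Y hRd0 𝒮 h𝒮' hZ2 hDv (hpi1 p hp.1)
    have hset : PI.filter (fun p => ¬ ∀ i, (p i).1 ≤ G₀) = PI.filter (fun p => ∃ i, (G₀ : ℝ) < ((p i).1 : ℝ)) := by
      refine Finset.filter_congr fun p _ => ?_
      push Not
      simp only [Nat.cast_lt]
    calc ∑ p ∈ PI.filter (fun p => ¬ ∀ i, (p i).1 ≤ G₀), Q p
        ≤ ∑ p ∈ PI.filter (fun p => ¬ ∀ i, (p i).1 ≤ G₀), ((piFinset (fun i => subBox (V i) L (p i))).card : ℝ) * E :=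
          Finset.sum_le_sum hbad
      _ = (∑ p ∈ PI.filter (fun p => ∃ i, (G₀ : ℝ) < ((p i).1 : ℝ)),
            ((piFinset (fun i => subBox (V i) L (p i))).card : ℝ)) * E := by rw [Finset.sum_mul, hset]
      _ ≤ ((k + 1 : ℕ) * (∏ i, (2 * V i)) * ((σ 0 L : ℝ) ^ 2) ^ (k + 1) * (G₀ : ℝ) ^ (-(1 / 2 : ℝ))) * E :=
          mul_le_mul_of_nonneg_right (sum_piFinset_idx_bad_le hL0 hV0 _ hG₀') hE0
      _ = _ := by push_cast; ring

end DrappeauTypeI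

end Literature.NumberTheory.Sieve

end
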